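import Summits.ResolutionOfSingularities.ResolutionOfSingularities.Theses.PAlteration
import Summits.ResolutionOfSingularities.ResolutionOfSingularities.Theorems.PAlterationPialtStubRRStability
import Summits.ResolutionOfSingularities.ResolutionOfSingularities.Theorems.PAlterationPialtReductions
import Summits.ResolutionOfSingularities.ResolutionOfSingularities.Theorems.PAlterationPialtRadicialCover
import Summits.ResolutionOfSingularities.ResolutionOfSingularities.Theorems.PAlterationPialtNormalizationInConverse
import Summits.ResolutionOfSingularities.ResolutionOfSingularities.Theorems.PAlterationPicoverResolutionGluing
import Literature.AlgebraicGeometry.Resolution.NormalizationInNormal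
import Literature.AlgebraicGeometry.Resolution.ProperModelsPatching
import Literature.AlgebraicGeometry.Resolution.ZariskiPatchingProperModels
import Literature.AlgebraicGeometry.Resolution.QuasiExcellentSchemes
import Literature.AlgebraicGeometry.Resolution.PurelyInseparableCompositum
import Literature.AlgebraicGeometry.Morphisms.OpenGluingProofs
import Literature.AlgebraicGeometry.Morphisms.NagataCompactification
import Literature.AlgebraicGeometry.Motives.FunctionFieldOver
import HarnessLib

/-!
# Sketch — helper-lemma statements for `stub_radicialPatching` (stub-ideation k = 1, FAMILY 1)

Scratch file of planner-sidea-stmt-ResolutionOfSingularities-0555-stub_radicialP-1-0; statements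
only (`sorry`), elaborated for type sanity. Not a skeleton; not registered.
-/

set_option linter.dupNamespace false
set_option linter.unusedVariables false

noncomputable section

open CategoryTheory CategoryTheory.Limits AlgebraicGeometry TopologicalSpace
open Literature.AlgebraicGeometry Literature.AlgebraicGeometry.Resolution
open Literature.AlgebraicGeometry.Morphisms
open Literature.AlgebraicGeometry.Motives (FunctionFieldOver)
open Summit.ResolutionOfSingularities.ResolutionOfSingularities.Theses.PAlteration (Pialt Picover)

namespace Summit.ResolutionOfSingularities.ResolutionOfSingularities.Cruxes.Pialt.StubIdeasRadicialPatching1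

/-- The conclusion of the crux at one scheme (verbatim shape of the stub's conclusion). -/
def PialtAt (Z : Scheme.{0}) : Prop :=
  ∃ (Z' : Scheme.{0}) (g : Z' ⟶ Z), IsProper g ∧ IsIntegral Z' ∧ Scheme.IsRegular Z' ∧
    Function.Surjective g.base ∧ ∃ U : Z.Opens, Dense (U : Set Z) ∧ IsFinite (g ∣_ U) ∧
      UniversallyInjective (g ∣_ U)

/-- Radicially regular (verbatim shape of the stub's local hypothesis). -/
def RR (Z : Scheme.{0}) : Prop :=
  ∃ (W : Scheme.{0}) (h : W ⟶ Z), IsIntegral W ∧ Scheme.IsRegular W ∧ IsFinite h ∧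
    UniversallyInjective h ∧ Function.Surjective h.base

/-! ## Plan C — resolve the charts of ONE global radicial cover by `Picover`, patch by Zariski–Piltant -/

/-- C1. Finitely many finite purely inseparable extensions of `K` embed into a common one
(iterate `Compositum`, `PurelyInseparableCompositum.lean`). -/
theorem exists_common_purelyInseparable_extension (K : Type) [Field K] {n : ℕ}
    (M : Fin n → Type) [∀ i, Field (M i)] [∀ i, Algebra K (M i)]
    [∀ i, FiniteDimensional K (M i)] [∀ i, IsPurelyInseparable K (M i)] :
    ∃ (L : Type) (_ : Field L) (_ : Algebra K L), FiniteDimensional K L ∧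
      IsPurelyInseparable K L ∧ ∀ i, Nonempty (M i →ₐ[K] L) := by
  sorry

/-- C2. Over an RR chart `U` with normal witness `h : W → U` and `K(W) ↪ L` over `K(Z)`, the piece
of `Z^L` over `U` is a finite radicial cover OF the regular `W` (it is `W^L`; `normalizationDesc`
+ `normalizationPullback` along the open immersion + cancellation of finite / UI). -/
theorem exists_finite_universallyInjective_hom_preimage_normalizationIn
    (Z : Scheme.{0}) [IsIntegral Z] (L : Type) [Field L] [Algebra Z.functionField L]
    [FiniteDimensional Z.functionField L] [IsPurelyInseparable Z.functionField L]
    (U : Z.Opens) (W : Scheme.{0}) [IsIntegral W] (h : W ⟶ (U : Scheme.{0})) [IsFinite h]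
    [UniversallyInjective h] (hsurj : Function.Surjective h.base)
    (hWn : ∀ w : W, IsIntegrallyClosed (W.presheaf.stalk w)) [IsDominant (h ≫ U.ι)]
    (e : FunctionFieldOver (h ≫ U.ι) →ₐ[Z.functionField] L) :
    ∃ g : ((normalizationInι Z L ⁻¹ᵁ U : (normalizationIn Z L).Opens) : Scheme.{0}) ⟶ W,
      IsFinite g ∧ UniversallyInjective g ∧ Function.Surjective g.base ∧
        g ≫ h = normalizationInι Z L ∣_ U := by
  sorry

/-- C3. `HasResolution` is Zariski-local for integral PROJECTIVE varieties, given two-model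
patching of proper models (Zariski 1944 / Piltant 2013 Cor. 5.7 run on the resolving system
"affine charts of the local resolutions"; variant of `hasResolution_of_properPatching_of_uniformizable`
with uniformization only for `K(V)`). -/
theorem hasResolution_of_forall_exists_open_hasResolution {p : ℕ} (k : Type) [Field k]
    [CharP k p] (hZ : ProperModel.TwoModelPatching.{0} p)
    (V : Scheme.{0}) [IsIntegral V] (f : V ⟶ Spec (.of k))
    (hproj : Motives.IsProjectiveOver (Over.mk f))
    (hloc : ∀ v : V, ∃ U : V.Opens, v ∈ U ∧ Scheme.HasResolution (U : Scheme.{0})) :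
    Scheme.HasResolution V := by
  sorry

/-- C3'. The same for separated `V` of finite type, given Nagata compactification
(`extension_of_nagata` + `n − 1` two-model patchings + restriction over `V`). -/
theorem hasResolution_of_forall_exists_open_hasResolution_of_nagata {p : ℕ} (k : Type) [Field k]
    [CharP k p] (hN : NagataCompactification.{0}) (hZ : ProperModel.TwoModelPatching.{0} p)
    (V : Scheme.{0}) [IsIntegral V] (f : V ⟶ Spec (.of k)) [IsSeparated f]
    [LocallyOfFiniteType f] [QuasiCompact f]
    (hloc : ∀ v : V, ∃ U : V.Opens, v ∈ U ∧ Scheme.HasResolution (U : Scheme.{0})) :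
    Scheme.HasResolution V := by
  sorry

/-- C-assembly (no perfectness used): `Picover ∧ TwoModelPatching (∧ Nagata for non-proper Z)`
give the stub. -/
theorem stub_radicialPatching_of_picover_of_twoModelPatching (hPc : Picover)
    (hTMP : ∀ p : ℕ, p.Prime → ProperModel.TwoModelPatching.{0} p)
    (hNag : NagataCompactification.{0})
    (p : ℕ) (hp : p.Prime) (k : Type) [Field k] [CharP k p] (Z : Scheme.{0})
    (f : Z ⟶ Spec (.of k)) [IsSeparated f] [LocallyOfFiniteType f] [QuasiCompact f]
    [IsIntegral Z] (hN : ∀ z : Z, IsIntegrallyClosed (Z.presheaf.stalk z))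
    (hL : ∀ z : Z, ∃ U : Z.Opens, z ∈ U ∧ RR (U : Scheme.{0})) : PialtAt Z := by
  sorry

/-! ## Plan B — one bad chart: strong `Picover` + extension by the identity (`OpenGluing_holds`) -/

/-- `Picover` with Cossart–Piltant's conclusion (ii): the resolution is an isomorphism over the
regular locus (shape of `SandwichedStrongResolution` / `CossartPiltant2019General`). -/
def StrongPicover : Prop :=
  ∀ p : ℕ, p.Prime → ∀ (k : Type) [Field k] [CharP k p] (Y X : Scheme.{0})
    (f : Y ⟶ Spec (.of k)) (g : X ⟶ Y), IsSeparated f → LocallyOfFiniteType f →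
    QuasiCompact f → IsIntegral Y → Scheme.IsRegular Y → IsIntegral X → IsFinite g →
    UniversallyInjective g → Function.Surjective g.base →
      ∃ (X' : Scheme.{0}) (π : X' ⟶ X), IsResolution π ∧
        ∃ W : X.Opens, (W : Set X) = Scheme.regularLocus X ∧ IsIso (π ∣_ W)

/-- B1. Extension by the identity: a strong resolution of an open `U ⊇ Sing Z` is the restriction
of a resolution of `Z` (`OpenGluing_holds` with `V = U`, `W = Reg Z`). -/
theorem hasResolution_of_strongResolution_open (Z : Scheme.{0}) [IsIntegral Z] (U : Z.Opens)
    (hsing : ∀ z : Z, z ∉ (U : Set Z) → IsRegularLocalRing (Z.presheaf.stalk z))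
    (hopen : IsOpen (Scheme.regularLocus Z))
    (R : Scheme.{0}) (π : R ⟶ (U : Scheme.{0})) (hπ : IsResolution π)
    (W : (U : Scheme.{0}).Opens)
    (hW : (W : Set (U : Scheme.{0})) = Scheme.regularLocus (U : Scheme.{0}))
    (hiso : IsIso (π ∣_ W)) :
    Scheme.HasResolution Z := by
  sorry

/-- B-assembly. Over a perfect field: if the singular locus of the normal `Z` lies inside ONE
radicially regular open, `StrongPicover` resolves `Z` (Frobenius domination
`exists_frobeniusCover_of_finite_universallyInjective` puts `U` in the `Picover` class; B1). -/
theorem hasResolution_of_rr_open_of_strongPicover (hS : StrongPicover) (p : ℕ) (hp : p.Prime)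
    (k : Type) [Field k] [CharP k p] [PerfectField k] (Z : Scheme.{0}) (f : Z ⟶ Spec (.of k))
    [IsSeparated f] [LocallyOfFiniteType f] [QuasiCompact f] [IsIntegral Z]
    (hN : ∀ z : Z, IsIntegrallyClosed (Z.presheaf.stalk z)) (U : Z.Opens)
    (hU : RR (U : Scheme.{0}))
    (hsing : ∀ z : Z, z ∉ (U : Set Z) → IsRegularLocalRing (Z.presheaf.stalk z)) :
    Scheme.HasResolution Z := by
  sorry

/-! ## Plan A — Zariski-canonical resolution of RR varieties (char-0 shape, Kollár 3.4.2 / 3.37) -/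

/-- A1. Birational rigidity: a morphism of `V`-schemes between birational integral `V`-schemes,
the target separated over `V`, is unique (`ext_of_isDominant_of_isSeparated` on the common
iso-locus). Makes cocycle conditions automatic when gluing chosen resolutions. -/
theorem hom_ext_of_isBirational {V R₁ R₂ : Scheme.{0}} [IsIntegral R₁] [IsIntegral R₂]
    (π₁ : R₁ ⟶ V) (π₂ : R₂ ⟶ V) [IsSeparated π₂] (h₁ : IsBirational π₁) (h₂ : IsBirational π₂)
    (e e' : R₁ ⟶ R₂) (he : e ≫ π₂ = π₁) (he' : e' ≫ π₂ = π₁) : e = e' := by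
  sorry

/-- A Zariski-canonical resolution on normal RR varieties over perfect fields of characteristic
`p`: a CHOICE of resolution for each, compatible with restriction to RR opens. -/
def ZariskiCanonicalResolutionRR (p : ℕ) : Prop :=
  ∀ (k : Type) [Field k] [CharP k p] [PerfectField k],
    ∃ res : ∀ X : Scheme.{0}, (Σ X' : Scheme.{0}, X' ⟶ X),
      (∀ (X : Scheme.{0}) (f : X ⟶ Spec (.of k)), IsSeparated f → LocallyOfFiniteType f →
        QuasiCompact f → IsIntegral X → (∀ x : X, IsIntegrallyClosed (X.presheaf.stalk x)) →
        RR X → IsResolution (res X).2) ∧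
      (∀ (X : Scheme.{0}) (f : X ⟶ Spec (.of k)) (U : X.Opens), IsSeparated f →
        LocallyOfFiniteType f → QuasiCompact f → IsIntegral X →
        (∀ x : X, IsIntegrallyClosed (X.presheaf.stalk x)) → RR X → RR (U : Scheme.{0}) →
        Nonempty (Arrow.mk (res (U : Scheme.{0})).2 ≅ Arrow.mk ((res X).2 ∣_ U)))

/-- A-assembly: canonical local resolutions glue (`hasResolution_of_relativeGluingData` over the
locally directed cover of `Z` by its RR affine opens; cocycles by A1). -/
theorem hasResolution_of_zariskiCanonicalResolutionRR {p : ℕ} (hA : ZariskiCanonicalResolutionRR p)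
    (hp : p.Prime) (k : Type) [Field k] [CharP k p] [PerfectField k] (Z : Scheme.{0})
    (f : Z ⟶ Spec (.of k)) [IsSeparated f] [LocallyOfFiniteType f] [QuasiCompact f]
    [IsIntegral Z] (hN : ∀ z : Z, IsIntegrallyClosed (Z.presheaf.stalk z))
    (hL : ∀ z : Z, ∃ U : Z.Opens, z ∈ U ∧ RR (U : Scheme.{0})) :
    Scheme.HasResolution Z := by
  sorry

/-! ## Shared last step (in tree): a resolution, or a resolvable radicial cover, gives the stub -/

example (Z : Scheme.{0}) [IsIntegral Z] (h : Scheme.HasResolution Z) : PialtAt Z :=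
  Theorems.pialtConclusion_of_hasResolution Z h

example {V Z : Scheme.{0}} [IsIntegral Z] [IsIntegral V] (ν : V ⟶ Z) [IsFinite ν]
    [UniversallyInjective ν] [Surjective ν] (h : PialtAt V) : PialtAt Z :=
  Theorems.pialtConclusion_of_finite_universallyInjective_surjective ν h

example {p : ℕ} (hp : p.Prime) (k : Type) [Field k] [CharP k p] (Z : Scheme.{0}) [IsIntegral Z]
    (f : Z ⟶ Spec (.of k)) [LocallyOfFiniteType f]
    (hN : ∀ z : Z, IsIntegrallyClosed (Z.presheaf.stalk z)) (L : Type) [Field L]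
    [Algebra Z.functionField L] [FiniteDimensional Z.functionField L]
    [IsPurelyInseparable Z.functionField L] (hres : Scheme.HasResolution (normalizationIn Z L)) :
    PialtAt Z :=
  Theorems.pialtConclusion_of_hasResolution_normalizationIn hp k Z f hN L hres

end Summit.ResolutionOfSingularities.ResolutionOfSingularities.Cruxes.Pialt.StubIdeasRadicialPatching1

end
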